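import Literature.Probability.RandomPlanarGeometry.SAWTriangularPolygonJoinFinal
import HarnessLib

/-!
# Corollaries of Madras' bound on the triangular lattice: the rooted form `#{rooted oriented N-gons} ≤ A·√N·μ(𝕋)^N` and the
# logarithmic form `log q_N(𝕋) ≤ N·log μ(𝕋) − ½·log N + C` (the exponent inequality «θ(𝕋) ≥ 1/2» as printed)

Topic `Literature/Probability/RandomPlanarGeometry` (lane «pcv-sawmu», a-p4 g12; a corollary sheet of `SAWTriangularPolygonJoinFinal.lean` — the
headline `triPolygonNumber_le_rpow_half : ∃ A, ∀ N ≥ 1, q_N(𝕋) ≤ A·N^{−1/2}·μ(𝕋)^N` of LINE «TRI-MADRAS» — with `SAWTriangularPolygonUnrooting.lean`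
(`triLoopCount_eq_mul_triPolygonNumber : triLoopCount N = 2N·q_N(𝕋)`, Madras–Slade (3.2.1) on `𝕋`) and `SAWTriangularPolygonMadrasBootstrap.lean`
(`triPolygonNumber_pos`)).

Source.  N. Madras, J. Stat. Phys. 78 (1995) 681–699 [Madras1995LatticeAnimalsExponent], §2 (`p_n ≤ A n^{−1/2} μ^n` in two dimensions, i.e. the
critical exponent inequality `θ ≥ 1/2` for `p_n ≈ μ^n n^{−θ}`; primary, not held by the lane), as recalled by A. Hammond, arXiv:1504.05286v5
[Hammond2015SAPJoining], §2 p. 4 ("θ_n ≥ 1/2 − o(1) for d = 2", with `p_n = n^{−θ_n} μ^n`, eq. (1.2) p. 2); the rooted normalisation is Madras–Slade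
(3.2.1) p. 63 (`2N q_N = 2d c_{N−1}(0,e)`; on `𝕋`: `triLoopCount N = 2N q_N(𝕋)`).

## Contents (namespace `Literature.Probability.RandomPlanarGeometry.SAW`; all `theorem`s, axioms standard)
* **`triLoopCount_le_sqrt_mul_pow`** — `∃ A, ∀ N ≥ 1, triLoopCount N ≤ A·√N·μ(𝕋)^N`: the number of `(N−1)`-step self-avoiding walks of `𝕋` from `0`
  ending at a neighbour of `0` (rooted oriented `N`-gons) is `O(√N·μ(𝕋)^N)`;
* **`log_triPolygonNumber_le`** — `∃ C, ∀ N ≥ 4, log q_N(𝕋) ≤ N·log μ(𝕋) − ½·log N + C` (Hammond's `θ_N ≥ 1/2 − C/log N`).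
-/

noncomputable section

open Literature.Probability.LatticeModels Literature.Probability.Percolation

namespace Literature.Probability.RandomPlanarGeometry.SAW

/-- **Madras' bound in the rooted normalisation**: `triLoopCount N ≤ A·√N·μ(𝕋)^N` for all `N ≥ 1` — the rooted oriented `N`-gons of the triangular
lattice (equivalently the `(N−1)`-step self-avoiding walks from `0` ending next to `0`) number `O(√N μ(𝕋)^N)`.
[cite: Madras1995LatticeAnimalsExponent, §2 (primary, not held by the lane); MadrasSlade1993, §3.2 eq. (3.2.1) p. 63; Hammond2015SAPJoining, §2 p. 4 (arXiv v5)] -/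
theorem triLoopCount_le_sqrt_mul_pow :
    ∃ A : ℝ, ∀ N : ℕ, 1 ≤ N → (triLoopCount N : ℝ) ≤ A * Real.sqrt N * Real.exp logMuTri ^ N := by
  obtain ⟨A, hA⟩ := triPolygonNumber_le_rpow_half
  set μ : ℝ := Real.exp logMuTri with hμ
  have hμ1 : 1 ≤ μ := Real.one_le_exp logMuTri_pos.le
  -- small `N`: a crude constant
  set B : ℝ := (triLoopCount 1 : ℝ) + triLoopCount 2 with hB
  have hB0 : 0 ≤ B := by positivity
  refine ⟨2 * max A 0 + B, fun N hN => ?_⟩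
  have hN0 : (0 : ℝ) < N := by exact_mod_cast (show 0 < N by omega)
  have hs1 : 1 ≤ Real.sqrt N := by
    rw [show (1 : ℝ) = Real.sqrt 1 by simp]
    exact Real.sqrt_le_sqrt (by exact_mod_cast hN)
  have hμN : 1 ≤ μ ^ N := one_le_pow₀ hμ1
  have hfac : 1 ≤ Real.sqrt N * μ ^ N := one_le_mul_of_one_le_of_one_le hs1 hμN
  by_cases h3 : 3 ≤ N
  · -- `triLoopCount N = 2N q_N ≤ 2N · A N^{-1/2} μ^N = 2A √N μ^N`
    have hq := hA N hN
    have hq' : (triPolygonNumber N : ℝ) ≤ max A 0 * (N : ℝ) ^ (-(1 / 2 : ℝ)) * μ ^ N :=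
      hq.trans (by gcongr; exact le_max_left _ _)
    have hL : (triLoopCount N : ℝ) = 2 * N * triPolygonNumber N := by
      exact_mod_cast triLoopCount_eq_mul_triPolygonNumber h3
    have hrpow : (N : ℝ) * (N : ℝ) ^ (-(1 / 2 : ℝ)) = Real.sqrt N := by
      rw [Real.rpow_neg hN0.le, ← Real.sqrt_eq_rpow]
      have hs : 0 < Real.sqrt (N : ℝ) := Real.sqrt_pos.2 hN0
      have hs2 : Real.sqrt (N : ℝ) * Real.sqrt N = N := Real.mul_self_sqrt hN0.le
      calc (N : ℝ) * (Real.sqrt N)⁻¹ = (Real.sqrt N * Real.sqrt N) * (Real.sqrt N)⁻¹ := by rw [hs2]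
        _ = Real.sqrt N := by rw [mul_assoc, mul_inv_cancel₀ hs.ne', mul_one]
    calc (triLoopCount N : ℝ) = 2 * N * triPolygonNumber N := hL
      _ ≤ 2 * N * (max A 0 * (N : ℝ) ^ (-(1 / 2 : ℝ)) * μ ^ N) := by gcongr
      _ = 2 * max A 0 * ((N : ℝ) * (N : ℝ) ^ (-(1 / 2 : ℝ))) * μ ^ N := by ring
      _ = 2 * max A 0 * Real.sqrt N * μ ^ N := by rw [hrpow]
      _ ≤ (2 * max A 0 + B) * Real.sqrt N * μ ^ N := by
          have : 0 ≤ Real.sqrt N * μ ^ N := by positivity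
          nlinarith
  · -- `N ∈ {1, 2}`
    have hsmall : (triLoopCount N : ℝ) ≤ B := by
      interval_cases N <;> simp [hB]
    calc (triLoopCount N : ℝ) ≤ B * 1 := by rw [mul_one]; exact hsmall
      _ ≤ B * (Real.sqrt N * μ ^ N) := mul_le_mul_of_nonneg_left hfac hB0
      _ ≤ (2 * max A 0 + B) * Real.sqrt N * μ ^ N := by
          have : 0 ≤ max A 0 * (Real.sqrt N * μ ^ N) := mul_nonneg (le_max_right _ _) (by positivity)
          nlinarith

/-- **The exponent inequality «θ(𝕋) ≥ 1/2» in logarithmic form**: `log q_N(𝕋) ≤ N·log μ(𝕋) − ½·log N + C` for all `N ≥ 4` (so Hammond's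
`θ_N := (N log μ − log q_N)/log N` satisfies `θ_N ≥ 1/2 − C/log N`).
[cite: Madras1995LatticeAnimalsExponent, §2 (primary, not held by the lane); Hammond2015SAPJoining, §2 p. 4 and eq. (1.2) p. 2 (arXiv v5: `p_n = n^{−θ_n} μ^n`, "θ_n ≥ 1/2 − o(1) for d = 2")] -/
theorem log_triPolygonNumber_le :
    ∃ C : ℝ, ∀ N : ℕ, 4 ≤ N → Real.log (triPolygonNumber N) ≤ N * logMuTri - 1 / 2 * Real.log N + C := by
  obtain ⟨A, hA⟩ := triPolygonNumber_le_rpow_half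
  refine ⟨Real.log (max A 1), fun N hN => ?_⟩
  have hN0 : (0 : ℝ) < N := by exact_mod_cast (show 0 < N by omega)
  have hq0 : (0 : ℝ) < triPolygonNumber N := by exact_mod_cast triPolygonNumber_pos hN
  have hA1 : (0 : ℝ) < max A 1 := lt_of_lt_of_le one_pos (le_max_right _ _)
  have hq : (triPolygonNumber N : ℝ) ≤ max A 1 * (N : ℝ) ^ (-(1 / 2 : ℝ)) * Real.exp logMuTri ^ N :=
    (hA N (by omega)).trans (by gcongr; exact le_max_left _ _)
  have hrhs : 0 < max A 1 * (N : ℝ) ^ (-(1 / 2 : ℝ)) * Real.exp logMuTri ^ N := by positivity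
  have hlog := Real.log_le_log hq0 hq
  rw [Real.log_mul (by positivity) (by positivity), Real.log_mul hA1.ne' (by positivity),
    Real.log_rpow hN0, Real.log_pow, Real.log_exp] at hlog
  linarith

end Literature.Probability.RandomPlanarGeometry.SAW

end
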